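import Mathlib
import HarnessLib
import Summits.Ventures.LatticeQCDFlow.Exactness.RadialPolar

/-!
# The standard Gaussian on `ℝ^ι` has a radial density; its direction is uniform on the sphere and independent of the radius

HONEST FRAMING: exact (Metropolis-corrected) sampling algorithms for lattice gauge theory;
figures of merit are autocorrelation/cost numbers at stated couplings and volumes; no
continuum-physics claim.

Venture `LatticeQCDFlow` (cell pub-lqcd), topic `Exactness`, FANOUT row 9 (eng-latcore, the
engine `latflow.core`).  NEW WORK of the cell over Mathlib (`ProbabilityTheory.stdGaussian`,
`map_pi_eq_stdGaussian`, `gaussianReal = gaussianPDF · volume`, the volume-preserving identification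
`EuclideanSpace ℝ ι ≃ (ι → ℝ)`) and row 9's `Exactness/RadialPolar.lean` (polar factorisation of a
radially weighted Haar measure).  Nothing is cited as a fact.  Printed counterparts, NAMED ONLY:
Maxwell 1860 / Herschel 1850 (a rotation-invariant product law is Gaussian — we use the converse
direction only); Muller 1959 (Commun. ACM 2, 19: normalised Gaussian vectors are uniform on the sphere).

## What is proved (`ι` a finite type, `E = EuclideanSpace ℝ ι`)

* `lintegral_prod_pi` — Tonelli for products: `∫ ∏ᵢ fᵢ(xᵢ) d(⊗μᵢ) = ∏ᵢ ∫ fᵢ dμᵢ` (σ-finite `μᵢ`,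
  measurable `fᵢ ≥ 0`); `pi_withDensity` — `⊗ᵢ (fᵢ · μᵢ) = (∏ᵢ fᵢ(xᵢ)) · ⊗ᵢ μᵢ`.
* **`stdGaussian_eq_withDensity`** — `stdGaussian E = (∏ᵢ gaussianPDF 0 1 (xᵢ)) · volume`, and the
  radial form **`stdGaussian_eq_withDensity_radial`**:
  `stdGaussian E = gaussRadial |ι| ‖x‖ · volume` with
  `gaussRadial d r = ofReal ((√(2π))⁻¹ ^ d · exp (−r²/2))`.
* **`stdGaussian_map_dirSphere_norm`** (`ι` nonempty) — under the standard Gaussian the pair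
  (direction, radius) has the PRODUCT law `uniformSphere volume ⊗ (stdGaussian E).map ‖·‖`; and
  **`stdGaussian_map_dirSphere`**: the direction `x/‖x‖` of a standard Gaussian vector is uniformly
  distributed on the unit sphere (Muller's method — how a uniform axis is sampled).

NOT CLAIMED: the converse (Maxwell's characterisation); the explicit radial (chi) law.
-/

namespace Summit.Ventures.LatticeQCDFlow.Exactness

open MeasureTheory Measure Metric Set ProbabilityTheory WithLp
open scoped ENNReal

/-! ## §1 Tonelli for finite products and product densities -/

section Pi

variable {ι : Type*} [Fintype ι] {α : ι → Type*} [∀ i, MeasurableSpace (α i)]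
  (μ : ∀ i, Measure (α i)) [∀ i, SigmaFinite (μ i)]

omit [Fintype ι] [∀ i, SigmaFinite (μ i)] in
/-- A constant factor comes out of a marginal integral. -/
theorem lmarginal_const_mul [DecidableEq ι] (s : Finset ι) (K : ℝ≥0∞) {g : (∀ i, α i) → ℝ≥0∞} (hg : Measurable g) :
    (∫⋯∫⁻_s, (fun x => K * g x) ∂μ) = fun y => K * (∫⋯∫⁻_s, g ∂μ) y := by
  funext y
  exact lintegral_const_mul K (hg.comp measurable_updateFinset)

omit [Fintype ι] in
/-- Marginal of a product over the integrated coordinates is the product of the integrals. -/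
theorem lmarginal_prod [DecidableEq ι] (s : Finset ι) {f : ∀ i, α i → ℝ≥0∞} (hf : ∀ i, Measurable (f i)) :
    (∫⋯∫⁻_s, (fun x => ∏ i ∈ s, f i (x i)) ∂μ) = fun _ => ∏ i ∈ s, ∫⁻ y, f i y ∂μ i := by
  induction s using Finset.induction with
  | empty =>
      funext x
      rw [lmarginal_empty]
      simp
  | insert i s hi ih =>
      have hmeas : Measurable fun x : ∀ i, α i => ∏ j ∈ insert i s, f j (x j) :=
        Finset.measurable_prod _ fun j _ => (hf j).comp (measurable_pi_apply j)
      rw [lmarginal_insert' _ hmeas hi]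
      have hinner : (fun x : ∀ i, α i => ∫⁻ xᵢ, (fun x => ∏ j ∈ insert i s, f j (x j))
          (Function.update x i xᵢ) ∂μ i) =
          fun x => (∫⁻ y, f i y ∂μ i) * ∏ j ∈ s, f j (x j) := by
        funext x
        have hrw : ∀ xᵢ, (∏ j ∈ insert i s, f j (Function.update x i xᵢ j)) =
            f i xᵢ * ∏ j ∈ s, f j (x j) := fun xᵢ => by
          rw [Finset.prod_insert hi, Function.update_self]
          congr 1
          exact Finset.prod_congr rfl fun j hj => by
            rw [Function.update_of_ne (ne_of_mem_of_not_mem hj hi)]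
        simp_rw [hrw]
        exact lintegral_mul_const _ (hf i)
      have hmeas_s : Measurable fun x : ∀ i, α i => ∏ j ∈ s, f j (x j) :=
        Finset.measurable_prod _ fun j _ => (hf j).comp (measurable_pi_apply j)
      rw [hinner, lmarginal_const_mul μ s _ hmeas_s, ih, Finset.prod_insert hi]

/-- **Tonelli for finite products**: `∫ ∏ᵢ fᵢ(xᵢ) d(⊗ᵢ μᵢ) = ∏ᵢ ∫ fᵢ dμᵢ`. -/
theorem lintegral_prod_pi {f : ∀ i, α i → ℝ≥0∞} (hf : ∀ i, Measurable (f i)) :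
    ∫⁻ x, ∏ i, f i (x i) ∂Measure.pi μ = ∏ i, ∫⁻ y, f i y ∂μ i := by
  classical
  rcases isEmpty_or_nonempty (∀ i, α i) with hE | ⟨⟨x₀⟩⟩
  · obtain ⟨i, hi⟩ := isEmpty_pi.1 hE
    rw [Measure.eq_zero_of_isEmpty (Measure.pi μ), lintegral_zero_measure]
    symm
    exact Finset.prod_eq_zero (Finset.mem_univ i)
      (by rw [Measure.eq_zero_of_isEmpty (μ i), lintegral_zero_measure])
  · rw [lintegral_eq_lmarginal_univ x₀, lmarginal_prod μ Finset.univ hf]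

/-- **Product densities**: if `νᵢ = fᵢ · μᵢ` (σ-finite) then `⊗ᵢ νᵢ = (∏ᵢ fᵢ(xᵢ)) · ⊗ᵢ μᵢ`. -/
theorem pi_withDensity (ν : ∀ i, Measure (α i)) [∀ i, SigmaFinite (ν i)] {f : ∀ i, α i → ℝ≥0∞}
    (hf : ∀ i, Measurable (f i)) (hν : ∀ i, ν i = (μ i).withDensity (f i)) :
    Measure.pi ν = (Measure.pi μ).withDensity (fun x => ∏ i, f i (x i)) := by
  refine Measure.pi_eq fun s hs => ?_
  rw [withDensity_apply _ (MeasurableSet.univ_pi hs), Measure.restrict_pi_pi,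
    lintegral_prod_pi _ hf]
  exact Finset.prod_congr rfl fun i _ => by rw [hν i, withDensity_apply _ (hs i)]

end Pi

/-! ## §2 The standard Gaussian on `EuclideanSpace ℝ ι` has a radial density -/

section Gaussian

variable (ι : Type*) [Fintype ι]

/-- The radial profile of the `d`-dimensional standard Gaussian density:
`(√(2π))⁻¹ ^ d · exp (−r²/2)`. -/
noncomputable def gaussRadial (d : ℕ) (r : ℝ) : ℝ≥0∞ :=
  ENNReal.ofReal (((Real.sqrt (2 * Real.pi))⁻¹) ^ d * Real.exp (-r ^ 2 / 2))

/-- The radial profile is measurable. -/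
theorem measurable_gaussRadial (d : ℕ) : Measurable (gaussRadial d) :=
  (measurable_const.mul (Real.measurable_exp.comp ((measurable_id.pow_const 2).neg.div_const 2))).ennreal_ofReal

/-- The product of one-dimensional standard normal densities is the radial profile at `‖x‖`. -/
theorem prod_gaussianPDF_eq_radial (x : EuclideanSpace ℝ ι) :
    (∏ i, gaussianPDF 0 1 (x i)) = gaussRadial (Fintype.card ι) ‖x‖ := by
  rw [gaussRadial, EuclideanSpace.real_norm_sq_eq]
  simp only [gaussianPDF, gaussianPDFReal]
  rw [← ENNReal.ofReal_prod_of_nonneg (fun i _ => by positivity)]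
  congr 1
  rw [Finset.prod_mul_distrib, Finset.prod_const, Finset.card_univ, ← Real.exp_sum]
  congr 1
  · simp
  · simp only [sub_zero, NNReal.coe_one, mul_one, neg_div, Finset.sum_neg_distrib, Finset.sum_div]

/-- **The standard Gaussian on `ℝ^ι` has density `∏ᵢ gaussianPDF 0 1 (xᵢ)` against volume.** -/
theorem stdGaussian_eq_withDensity :
    stdGaussian (EuclideanSpace ℝ ι) =
      (volume : Measure (EuclideanSpace ℝ ι)).withDensity (fun x => ∏ i, gaussianPDF 0 1 (x i)) := by
  have hpdf : Measurable (gaussianPDF 0 1) := measurable_gaussianPDF 0 1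
  have hG : Measurable fun x : EuclideanSpace ℝ ι => ∏ i, gaussianPDF 0 1 (x i) :=
    Finset.measurable_prod _ fun i _ => hpdf.comp ((measurable_pi_apply i).comp (measurable_ofLp 2 _))
  rw [← map_pi_eq_stdGaussian, pi_withDensity (fun _ : ι => (volume : Measure ℝ))
    (fun _ : ι => gaussianReal 0 1) (fun _ => hpdf) (fun _ => gaussianReal_of_var_ne_zero 0 one_ne_zero),
    ← volume_pi]
  -- push the weight through the measurable equivalence `toLp 2`
  have hcomp : (fun x : ι → ℝ => ∏ i, gaussianPDF 0 1 (x i)) =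
      (fun x : EuclideanSpace ℝ ι => ∏ i, gaussianPDF 0 1 (x i)) ∘ (MeasurableEquiv.toLp 2 (ι → ℝ)) := by
    funext x
    rfl
  rw [hcomp, ← MeasurableEquiv.coe_toLp, map_withDensity_equiv _ _ hG, MeasurableEquiv.coe_toLp,
    (PiLp.volume_preserving_toLp ι).map_eq]

/-- **Radial form**: `stdGaussian (ℝ^ι) = gaussRadial |ι| (‖x‖) · volume`. -/
theorem stdGaussian_eq_withDensity_radial :
    stdGaussian (EuclideanSpace ℝ ι) =
      (volume : Measure (EuclideanSpace ℝ ι)).withDensity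
        (fun x => gaussRadial (Fintype.card ι) ‖x‖) := by
  rw [stdGaussian_eq_withDensity]
  congr 1
  funext x
  exact prod_gaussianPDF_eq_radial ι x

/-- The radially weighted volume IS the standard Gaussian, hence a probability (finite) measure. -/
instance isFiniteMeasure_volume_withDensity_gaussRadial :
    IsFiniteMeasure ((volume : Measure (EuclideanSpace ℝ ι)).withDensity
      (fun x => gaussRadial (Fintype.card ι) ‖x‖)) := by
  rw [← stdGaussian_eq_withDensity_radial]
  infer_instance

variable [Nonempty ι]

/-- **Under the standard Gaussian, (direction, radius) has a product law**: the direction is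
uniform on the unit sphere and independent of the radius. -/
theorem stdGaussian_map_dirSphere_norm :
    (stdGaussian (EuclideanSpace ℝ ι)).map (fun y => (dirSphere y, ‖y‖)) =
      (uniformSphere (volume : Measure (EuclideanSpace ℝ ι))).prod
        ((stdGaussian (EuclideanSpace ℝ ι)).map fun y => ‖y‖) := by
  rw [stdGaussian_eq_withDensity_radial]
  exact map_dirSphere_norm_radial (μ := (volume : Measure (EuclideanSpace ℝ ι)))
    (measurable_gaussRadial (Fintype.card ι))

/-- **Muller's method**: the direction of a standard Gaussian vector is uniform on the sphere. -/
theorem stdGaussian_map_dirSphere :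
    (stdGaussian (EuclideanSpace ℝ ι)).map dirSphere =
      uniformSphere (volume : Measure (EuclideanSpace ℝ ι)) := by
  rw [stdGaussian_eq_withDensity_radial, map_dirSphere_radial (μ := volume)
    (measurable_gaussRadial (Fintype.card ι)), ← stdGaussian_eq_withDensity_radial, measure_univ,
    one_smul]

end Gaussian

end Summit.Ventures.LatticeQCDFlow.Exactness
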